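import Summits.RiemannHypothesis.RiemannHypothesis.Theorems.TiltedLandingLaw421FieldSplitNodeA

/-! # TiltedLandingLaw421FieldSplitNodeB
c12 FieldSplit node, part B: §H.7 finiteness (`finite_zeros_closedBall_of_entire`, `stColP_level_finite`, `hasLowestSig_stCol'`) and the LOW/LOW pair (`IsolatedPairDropLow(G)`, `descentSigS'_of_fieldSplitLowLow`) — the statements of the registered stubs of `Lines/fieldsplit_v1.lean`.
SUPPORT module for crux `TiltedLandingLaw421` (stmt-RiemannHypothesis-24774), `--supports` only: proves no stub, no crux; fully proved (no `sorry`).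
Packaged by C4 rh-idea-6 g21 per director (CA239)(1) in the (CA237) lint shape. RH is not proved. -/

namespace RhW07.C12.FieldSplit

open Set Complex
open RhIdea6.G17.W07C7 RhIdea6.G17.W07C7.Rev6 RhIdea6.G18.W07C8.Law421BirthS RhIdea6.G19.W07C11.Seam
open RhIdea6.G20.W07C12.Frac RhIdea6.G20.W07C12.StColP

/-- `finite_zeros_closedBall_of_entire` (W-07 c12 FieldSplit node for crux TiltedLandingLaw421; token-identical to the registered line fieldsplit_v1 d6eb6582). -/
theorem finite_zeros_closedBall_of_entire {g : ℂ → ℂ} (hg : Differentiable ℂ g) (hne : g ≠ 0) (c : ℂ) (ρ : ℝ) :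
   {w : ℂ | w ∈ Metric.closedBall c ρ ∧ g w = 0}.Finite := by
 have hga : AnalyticOnNhd ℂ g (Metric.closedBall c ρ) := fun z _ => hg.analyticAt z
 refine ((MeromorphicOn.divisor g (Metric.closedBall c ρ)).finiteSupport (isCompact_closedBall c ρ)).subset ?_
 rintro w ⟨hwK, hgw⟩
 rw [Function.mem_support, hga.meromorphicOn.divisor_apply hwK, (hga w hwK).meromorphicOrderAt_eq]
 have hntop : analyticOrderAt g w ≠ ⊤ := by
   intro htop
   have huniv : AnalyticOnNhd ℂ g Set.univ := fun z _ => hg.analyticAt z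
   have hall := huniv.eqOn_zero_of_preconnected_of_eventuallyEq_zero isPreconnected_univ (Set.mem_univ w)
     (analyticOrderAt_eq_top.mp htop)
   exact hne (funext fun z => hall (Set.mem_univ z))
 have hne0 : analyticOrderAt g w ≠ 0 := by
   rw [Ne, (hga w hwK).analyticOrderAt_eq_zero]; exact fun h => h hgw
 obtain ⟨n, hn⟩ := ENat.ne_top_iff_exists.mp hntop
 rw [← hn] at hne0 ⊢
 have hn0 : n ≠ 0 := fun h0 => hne0 (by simp [h0])
 simp [hn0]

/-- `stColP_level_finite` (W-07 c12 FieldSplit node for crux TiltedLandingLaw421; token-identical to the registered line fieldsplit_v1 d6eb6582). -/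
theorem stColP_level_finite {η : ℝ} {f : ℂ → ℂ} {x₀ s hmax R Hs : ℝ} {B : ℕ} (hE : EngineHyps5 2 η f x₀ s hmax R Hs B) (j : ℕ) :
   {w : ℂ | StCol' η f x₀ s hmax R Hs B j w}.Finite := by
 obtain ⟨hdiff, -⟩ := hE
 by_cases hg : iteratedDeriv j f = 0
 · have : {w : ℂ | StCol' η f x₀ s hmax R Hs B j w} = ∅ := by
     ext w
     simp only [Set.mem_setOf_eq, Set.mem_empty_iff_false, iff_false]
     exact fun hw => hw.1 hg
   rw [this]; exact Set.finite_empty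
 · have hgd : Differentiable ℂ (iteratedDeriv j f) := Literature.Analysis.Complex.differentiable_iteratedDeriv_of_entire hdiff j
   refine (finite_zeros_closedBall_of_entire hgd hg (x₀ : ℂ) (R / 2 + (j : ℝ) * (s / 4) + Hs)).subset ?_
   intro w hw
   obtain ⟨-, hw0, hwim, hwre, hwHs⟩ := hw
   refine ⟨?_, hw0⟩
   rw [Metric.mem_closedBall, dist_eq_norm]
   have h1 : ‖w - (x₀ : ℂ)‖ ≤ |(w - (x₀ : ℂ)).re| + |(w - (x₀ : ℂ)).im| := Complex.norm_le_abs_re_add_abs_im _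
   have h2 : (w - (x₀ : ℂ)).re = w.re - x₀ := by simp
   have h3 : (w - (x₀ : ℂ)).im = w.im := by simp
   rw [h2, h3, abs_of_pos hwim] at h1
   linarith

/-- `hasLowestSig_stCol'` (W-07 c12 FieldSplit node for crux TiltedLandingLaw421; token-identical to the registered line fieldsplit_v1 d6eb6582). -/
theorem hasLowestSig_stCol' : HasLowestSig StCol' := by
 intro η f x₀ s hmax R Hs B hE j u hS
 have hfin := stColP_level_finite hE j
 have hne : {w : ℂ | StCol' η f x₀ s hmax R Hs B j w}.Nonempty := ⟨u, hS⟩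
 obtain ⟨v, hv, hmin⟩ := hfin.exists_minimalFor Complex.im _ hne
 refine ⟨v, hv, fun w hw => ?_⟩
 by_contra hlt
 rw [not_le] at hlt
 exact absurd (hmin hw hlt.le) (not_le.mpr hlt)

/-- `denseLevelCensusStop_of_low'` (W-07 c12 FieldSplit node for crux TiltedLandingLaw421; token-identical to the registered line fieldsplit_v1 d6eb6582). -/
theorem denseLevelCensusStop_of_low' {P : StatePred} (h : DenseLevelCensusStopLow P) : DenseLevelCensusStop P :=
 denseLevelCensusStop_of_low hasLowestSig_stCol' h

/-- `descentSigS'_of_fieldSplitLow'` (W-07 c12 FieldSplit node for crux TiltedLandingLaw421; token-identical to the registered line fieldsplit_v1 d6eb6582). -/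
theorem descentSigS'_of_fieldSplitLow' {P : StatePred} (hα : IsolatedPairDrop P) (hβ : DenseLevelCensusStopLow P) : DescentSigS' :=
 descentSigS'_of_fieldSplitLow hasLowestSig_stCol' hα hβ

end RhW07.C12.FieldSplit

namespace RhW07.C12.FieldSplit

open Set Complex
open RhIdea6.G17.W07C7 RhIdea6.G17.W07C7.Rev6 RhIdea6.G18.W07C8.Law421BirthS RhIdea6.G19.W07C11.Seam
open RhIdea6.G20.W07C12.Frac RhIdea6.G20.W07C12.StColP

/-- `IsolatedPairDropLowG` (W-07 c12 FieldSplit node for crux TiltedLandingLaw421; token-identical to the registered line fieldsplit_v1 d6eb6582). -/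
def IsolatedPairDropLowG (μ : ℝ) (P St Ready : StatePred) : Prop :=
 ∀ (η : ℝ) (f : ℂ → ℂ) (x₀ s hmax R Hs : ℝ) (B : ℕ), EngineHyps5 2 η f x₀ s hmax R Hs B →
   ∀ (j : ℕ) (v : ℂ), IsLowest St η f x₀ s hmax R Hs B j v → ¬ Ready η f x₀ s hmax R Hs B j v →
     P η f x₀ s hmax R Hs B j v → SuccOf μ St η f x₀ s hmax R Hs B j v

/-- `IsolatedPairDropLow` (W-07 c12 FieldSplit node for crux TiltedLandingLaw421; token-identical to the registered line fieldsplit_v1 d6eb6582). -/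
def IsolatedPairDropLow (P : StatePred) : Prop := IsolatedPairDropLowG (1 / 4) P StCol' (CumReady WindowReady)

/-- `isolatedPairDropLow_of` (W-07 c12 FieldSplit node for crux TiltedLandingLaw421; token-identical to the registered line fieldsplit_v1 d6eb6582). -/
theorem isolatedPairDropLow_of {P : StatePred} (h : IsolatedPairDrop P) : IsolatedPairDropLow P :=
 fun η f x₀ s hmax R Hs B hE j v hv hR hP => h η f x₀ s hmax R Hs B hE j v hv.1 hR hP

/-- `surplusLiftSigStop_of_fieldSplitLow` (W-07 c12 FieldSplit node for crux TiltedLandingLaw421; token-identical to the registered line fieldsplit_v1 d6eb6582). -/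
theorem surplusLiftSigStop_of_fieldSplitLow {P : StatePred} (hα : IsolatedPairDropLow P) (hβ : DenseLevelCensusStopLow P) :
   SurplusLiftSigStop (1 / 4) 1 := by
 intro η f x₀ s hmax R Hs B hE
 obtain ⟨E, lam, hlam0, hsum, hoff, hon⟩ := hβ η f x₀ s hmax R Hs B hE
 refine ⟨E, lam, hlam0, hsum, ?_, hon⟩
 intro j u hj hS
 by_cases hR : CumReady WindowReady η f x₀ s hmax R Hs B j u
 · exact Or.inl hR
 · obtain ⟨v, hv⟩ := hasLowestSig_stCol' η f x₀ s hmax R Hs B hE j u hS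
   have hRv : ¬ CumReady WindowReady η f x₀ s hmax R Hs B j v := hR
   have hPv := hoff j v hj hv hRv
   obtain ⟨u', hS', hdrop⟩ := hα η f x₀ s hmax R Hs B hE j v hv hRv hPv
   refine Or.inr ⟨u', hS', le_trans hdrop ?_⟩
   rw [abs_of_pos hv.1.2.2.1, abs_of_pos hS.2.2.1]
   exact hv.2 u hS

/-- `descentSigS'_of_fieldSplitLowLow` (W-07 c12 FieldSplit node for crux TiltedLandingLaw421; token-identical to the registered line fieldsplit_v1 d6eb6582). -/
theorem descentSigS'_of_fieldSplitLowLow {P : StatePred} (hα : IsolatedPairDropLow P) (hβ : DenseLevelCensusStopLow P) : DescentSigS' :=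
 descentSigS'_of_stop le_rfl (surplusLiftSigStop_of_fieldSplitLow hα hβ)

end RhW07.C12.FieldSplit
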